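import Mathlib.Algebra.Polynomial.SpecificDegree
import Mathlib.RingTheory.Polynomial.UniqueFactorization
import Mathlib.Algebra.MvPolynomial.Equiv
import Mathlib.Algebra.MvPolynomial.NoZeroDivisors
import Mathlib.Algebra.MvPolynomial.PDeriv
import Mathlib.RingTheory.Spectrum.Prime.RingHom
import Mathlib.Algebra.Field.ULift
import Literature.AlgebraicGeometry.Resolution.RegularLocalRingsJacobian
import Literature.AlgebraicGeometry.Resolution.PowerSeriesRegularLocal
import Literature.AlgebraicGeometry.Resolution.CofinalityFromPrincipalization
import Literature.AlgebraicGeometry.Resolution.ExtAnnihilatorAffineGlobal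
import Literature.AlgebraicGeometry.Resolution.AffineDomainEquidim
import Literature.AlgebraicGeometry.Resolution.EmbeddedResolutionExcellentSurfacesSequence
import Literature.AlgebraicGeometry.Resolution.StrictNormalCrossingsFlatDescent
import Literature.AlgebraicGeometry.Resolution.NormalCrossingsLocal
import Literature.AlgebraicGeometry.Resolution.ExcellentRingsFieldProofs
import Literature.AlgebraicGeometry.Resolution.BlowupStalkCharts
import Literature.AlgebraicGeometry.Resolution.BlowupDimension
import Literature.AlgebraicGeometry.Resolution.StalkIdealLemmas

import HarnessLib

/-!
# The cusp refutes `CossartJannsenSaito2020EmbeddedSequence` as typed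

Topic: `Literature/AlgebraicGeometry/Resolution`. KERNEL CERTIFICATE for the correction record of
`EmbeddedResolutionExcellentSurfacesSequence.lean` (2026-08-27): the named fact
`CossartJannsenSaito2020EmbeddedSequence` — Cossart–Jannsen–Saito 2020, Thm. 1.4 for `B = ∅`, typed
with the Introduction's summary clause «`D_i ⊂ (X_i)_sing`» (constructor field `hsing` of
`IsBPermissibleSequence`) at EVERY step together with the end clause «`X₁` and `B₁` intersect
transversally» (p. 7) — is FALSE, in every universe:

* `not_cossartJannsenSaito2020EmbeddedSequence : ¬ CossartJannsenSaito2020EmbeddedSequence`.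

Nothing else of the tree is touched: the superseded fact keeps its name (it is cited on the
res-hironaka bus as F-32b), consumers use the corrected `CossartJannsenSaito2020EmbeddedSequenceB`
(per-step clause of Thm. 6.9 (a) / Def. 6.1 (2): «singular point of `X_j` OR on `B_j`», book
pp. 79, 82–83 and p. 7: «for the sequence `S(X, ∅)`, `𝓑_i` is not empty for `i > 0`»), which is
not refuted by this witness (its second centre, the tangency point, lies on `B₁`).

## The witness and the argument (everything is proved in this file; helpers are `private`, in the
namespace `Literature.AlgebraicGeometry.Resolution.CuspCounterexample`)

`k = ℚ` lifted to `Type u`; `Z = 𝔸²_k = Spec k[x₀, x₁]` (Noetherian, regular, excellent);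
`X = V(f) ⊂ Z` with `f = x₀² − x₁³`, a reduced closed subscheme of dimension `≤ 2`; `s = V(x₀, x₁)`
the cusp point; `ξ = (f)` the generic point of `X`. This is the textbook example «blow up the
cuspidal cubic `y² = x³` at `O`: the strict transform `Ỹ` is nonsingular and meets the exceptional
curve `E` in one point» [cite: Hartshorne1977, Ch. I, Exercise 4.10 and Exercise 5.6 (a)] — at that
point `Ỹ` is tangent to `E`, so «`D_i ⊂ (X_i)_sing` at every step» allows exactly one blow-up and
the end state is never transversal.

* §A  `f` is prime; by the Jacobian criterion (`RegularLocalRingsJacobian.lean`, characteristic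
  `0`) the local rings of `X` are regular exactly off `s`.
* §B–§B3  the `Spec` dictionary (points of the plane as prime ideals, stalks as localisations, the
  reduced structure `𝓘_X` with stalks `(f)`), and the hypotheses of the fact for `i : X → Z`.
* §D1  «`𝒪_{Z,x} ⧸ (𝓘_S)_x` regular» is invariant under open immersions (for the transport along
  isomorphisms and along the blow-up off its centre).
* §C  `chart_core`: for ANY blow-up `π : Z₁ → Z` along `𝔪_s` (`IsBlowup`, universal property), a
  point `P` over `s` and a generisation `η' ⤳ P` over `ξ`, the Rees-algebra chart at `P`
  (`BlowupStalkCharts`, `BlowupChartRsop`) must be the `x₁`-chart, and `a = x₁`, `b = x₀/x₁` form a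
  regular system of parameters of the two-dimensional regular local ring `𝒪_{Z₁,P}` with
  `π^* f = a² (b² − a)`, `b² − a ∈ 𝔭_{η'} ∌ a`, `𝔪_s · 𝒪_{Z₁,P} = (a)`.
* §M  over `s` the strict transform `closure {η'}` has stalk ideal `𝔭_{η'} = (b² − a)` and is
  regular (Matsumura 14.2/14.3 via `RegularLocalRingsQuotient.lean`); §P off `s` it is regular too
  (there `π` is an open immersion, `BlowupsIntegral.lean`); §E over `s` it is NOT transversal
  (CJS Def. 4.1, the tree's `IsTransversalWith`) to any `B ⊇ π⁻¹(s)`: `I_D ≤ 𝔭_{η'}`, `0 ≠ π^* f ∈ I_D`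
  and `I_B ≤ √(a) = (a)` force `r = e = 1`, `J = {0}` and `𝔪 ≤ 𝔭_{η'} + (a)`, which fails for `b`.
* §S  `seq_invariant`, by induction on `IsBPermissibleSequence X ∅ σ X' B'`: EITHER every centre so
  far was empty (`σ` is an isomorphism, `X' = σ⁻¹ X`, `B' = ∅`), OR exactly one was not, and it was
  the point over `s` with its reduced structure (`V(C)` is regular, lies in `σ⁻¹(s)` by `hsing` and
  §A, so `C = σ^* 𝔪_s`): `σ` is a blow-up along `𝔪_s`, `X' = closure {η'}`, `B' = σ⁻¹(s)`; after
  that `hsing` admits no centre (§M, §P), so all later steps are isomorphisms.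
* The refutation: in the first case the end clause `IsTransversalWith Z₁ X₁ B₁` at the point over
  `s` makes `𝒪_{X,s}` regular (`IsRsopPart.isRegularLocalRing_quotient`) — it is not (§A); in the
  second case `π` is proper, so `closure {η'}` has a point over `s`, and §E applies.

## Sources

* V. Cossart, U. Jannsen, S. Saito, *Desingularization: Invariants and Strategy*, LNM 2270 (2020):
  Thm. 1.4 with the "More precisely" paragraph (pp. 5–6), p. 7 (proof of Cor. 1.5), Def. 4.1
  (p. 49), Def. 6.1 (2) (p. 79), (6.2)/Def. 6.8 (p. 82), Thm. 6.9 (a) (p. 83). [CossartJannsenSaito2020]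
* R. Hartshorne, *Algebraic Geometry*, GTM 52 (1977): Ch. I, Exercise 4.10 (blowing up the cuspidal
  cubic), Exercise 5.6 (a). [Hartshorne1977]
-/

/-! ## §A The cusp polynomial `f = x₀² − x₁³`: prime, singular exactly at the origin -/

noncomputable section

open MvPolynomial IsLocalRing CategoryTheory AlgebraicGeometry TopologicalSpace

universe u

open Literature.AlgebraicGeometry.Resolution

namespace Literature.AlgebraicGeometry.Resolution.CuspCounterexample

open Scheme.IdealSheafData

variable (k : Type u) [Field k]

/-- The cusp polynomial `f = x₀² − x₁³ ∈ k[x₀, x₁]`. [folklore] -/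
private def cuspPoly : MvPolynomial (Fin 2) k := X 0 ^ 2 - X 1 ^ 3

/-- The ideal `𝔪₀ = (x₀, x₁)` of the origin. [folklore] -/
private def originIdeal : Ideal (MvPolynomial (Fin 2) k) := RingHom.ker (eval (0 : Fin 2 → k))

/-- The coordinates vanish at the origin: `xᵢ ∈ 𝔪₀`. [folklore] -/
private theorem X_mem_originIdeal (i : Fin 2) : (X i : MvPolynomial (Fin 2) k) ∈ originIdeal k := by
  simp [originIdeal, RingHom.mem_ker]

/-- `𝔪₀` is a maximal ideal (the kernel of evaluation at `0` onto the field `k`). [folklore] -/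
private theorem isMaximal_originIdeal : (originIdeal k).IsMaximal :=
  RingHom.ker_isMaximal_of_surjective (eval (0 : Fin 2 → k))
    (fun a => ⟨C a, by simp⟩)

/-- `f ∈ 𝔪₀`: the origin lies on the cusp. [folklore] -/
private theorem cuspPoly_mem_originIdeal : cuspPoly k ∈ originIdeal k := by
  simp [originIdeal, cuspPoly, RingHom.mem_ker]

/-- `f ≠ 0`. [folklore] -/
private theorem cuspPoly_ne_zero : cuspPoly k ≠ 0 := by
  intro h
  have := congrArg (eval (fun i : Fin 2 => if i = 0 then (1 : k) else 0)) h
  simp [cuspPoly] at this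

/-- Under `k[x₀,x₁] ≃ k[x₁][Y]` (`finSuccEquiv`, `x₀ ↦ Y`), `f ↦ Y² − C(x₁³)`. [folklore] -/
private theorem finSuccEquiv_cuspPoly :
    finSuccEquiv k 1 (cuspPoly k) =
      Polynomial.X ^ 2 - Polynomial.C ((X 0 : MvPolynomial (Fin 1) k) ^ 3) := by
  have h1 : finSuccEquiv k 1 (X 1) = Polynomial.C (X 0) := by
    have : (1 : Fin 2) = (0 : Fin 1).succ := rfl
    rw [this, finSuccEquiv_X_succ]
  simp [cuspPoly, map_sub, map_pow, finSuccEquiv_X_zero, h1]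

/-- `x₁³` is not a square in `k[x₁]` (degree count). [folklore] -/
private theorem not_isSquare_X_pow_three (a : MvPolynomial (Fin 1) k) : a ^ 2 ≠ (X 0) ^ 3 := by
  intro h
  have ha : a ≠ 0 := by
    intro ha
    rw [ha, zero_pow two_ne_zero] at h
    exact (pow_ne_zero 3 (X_ne_zero (0 : Fin 1))) h.symm
  have hdeg := congrArg totalDegree h
  rw [pow_two, totalDegree_mul_of_isDomain ha ha, totalDegree_X_pow] at hdeg
  omega

/-- `f = x₀² − x₁³` is irreducible (a monic quadratic in `x₀` over `k[x₁]` without a root, `x₁³` not being a square). [folklore] -/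
private theorem irreducible_cuspPoly : Irreducible (cuspPoly k) := by
  have hmonic : (Polynomial.X ^ 2 - Polynomial.C ((X 0 : MvPolynomial (Fin 1) k) ^ 3)).Monic :=
    Polynomial.monic_X_pow_sub_C _ two_ne_zero
  have hdeg : (Polynomial.X ^ 2 - Polynomial.C ((X 0 : MvPolynomial (Fin 1) k) ^ 3)).natDegree = 2 :=
    Polynomial.natDegree_X_pow_sub_C
  have hirr : Irreducible
      (Polynomial.X ^ 2 - Polynomial.C ((X 0 : MvPolynomial (Fin 1) k) ^ 3)) := by
    rw [hmonic.irreducible_iff_roots_eq_zero_of_degree_le_three (by omega) (by omega),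
      Multiset.eq_zero_iff_forall_notMem]
    intro a ha
    rw [Polynomial.mem_roots hmonic.ne_zero, Polynomial.IsRoot, Polynomial.eval_sub,
      Polynomial.eval_pow, Polynomial.eval_X, Polynomial.eval_C, sub_eq_zero] at ha
    exact not_isSquare_X_pow_three k a ha
  rw [← finSuccEquiv_cuspPoly] at hirr
  exact (MulEquiv.irreducible_iff (finSuccEquiv k 1).toMulEquiv).mp hirr

/-- `f` is a prime element of `k[x₀, x₁]`. [folklore] -/
private theorem prime_cuspPoly : Prime (cuspPoly k) :=
  (irreducible_cuspPoly k).prime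

/-- `(f)` is a prime ideal. [folklore] -/
private theorem isPrime_span_cuspPoly : (Ideal.span {cuspPoly k}).IsPrime := by
  rw [Ideal.span_singleton_prime (cuspPoly_ne_zero k)]
  exact prime_cuspPoly k

/-- `∂f/∂x₀ = 2x₀`. [folklore] -/
private theorem pderiv_zero_cuspPoly : pderiv 0 (cuspPoly k) = C (2 : k) * X 0 := by
  simp [cuspPoly, pderiv_X, map_sub, map_ofNat]

/-- `∂f/∂x₁ = −3x₁²`. [folklore] -/
private theorem pderiv_one_cuspPoly : pderiv 1 (cuspPoly k) = - (C (3 : k) * X 1 ^ 2) := by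
  simp [cuspPoly, map_sub, map_ofNat]

/-- A polynomial vanishing at the origin lies in every ideal containing the variables. [folklore] -/
private theorem originIdeal_le_of_X_mem {Q : Ideal (MvPolynomial (Fin 2) k)} (h : ∀ i, (X i : (MvPolynomial (Fin 2) k)) ∈ Q) : originIdeal k ≤ Q := by
  intro p hp
  have hp0 : constantCoeff p = 0 := by
    have : eval (0 : Fin 2 → k) p = 0 := hp
    rwa [MvPolynomial.eval_zero] at this
  have hmem : p ∈ Ideal.span (Set.range (X : Fin 2 → (MvPolynomial (Fin 2) k))) := by
    rw [show Set.range (X : Fin 2 → (MvPolynomial (Fin 2) k)) = X '' Set.univ from Set.image_univ.symm,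
      mem_ideal_span_X_image]
    intro m hm
    by_contra hcon
    push Not at hcon
    have hm0 : m = 0 := by
      ext i
      simpa using hcon i (Set.mem_univ i)
    rw [hm0, MvPolynomial.mem_support_iff, ← constantCoeff_eq] at hm
    exact hm hp0
  refine Ideal.span_le.mpr ?_ hmem
  rintro _ ⟨i, rfl⟩
  exact h i

/-- **Regular locus of the cusp**: away from the origin the hypersurface `k[x₀,x₁]/(f)` is
regular (char `k` = 0: the gradient `(2x₀, −3x₁²)` vanishes only at the origin). [folklore] -/
private theorem isRegularLocalRing_of_ne_origin [CharZero k]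
    (P : Ideal ((MvPolynomial (Fin 2) k) ⧸ Ideal.span {cuspPoly k})) [P.IsPrime]
    (hP : P.comap (Ideal.Quotient.mk (Ideal.span {cuspPoly k})) ≠ originIdeal k) :
    IsRegularLocalRing (Localization.AtPrime P) := by
  by_contra hreg
  set Q := P.comap (Ideal.Quotient.mk (Ideal.span {cuspPoly k})) with hQ
  haveI : Q.IsPrime := Ideal.comap_isPrime _ P
  have h0 : (pderiv 0) (cuspPoly k) ∈ Q :=
    Derivation.apply_mem_comap_of_not_isRegularLocalRing (pderiv 0) (cuspPoly k) P hreg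
  have h1 : (pderiv 1) (cuspPoly k) ∈ Q :=
    Derivation.apply_mem_comap_of_not_isRegularLocalRing (pderiv 1) (cuspPoly k) P hreg
  rw [pderiv_zero_cuspPoly] at h0
  rw [pderiv_one_cuspPoly, neg_mem_iff] at h1
  have hC2 : IsUnit (C (2 : k) : (MvPolynomial (Fin 2) k)) := (isUnit_iff_ne_zero.mpr (by norm_num)).map C
  have hC3 : IsUnit (C (3 : k) : (MvPolynomial (Fin 2) k)) := (isUnit_iff_ne_zero.mpr (by norm_num)).map C
  have hX0 : (X 0 : (MvPolynomial (Fin 2) k)) ∈ Q := by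
    rcases (Ideal.IsPrime.mem_or_mem ‹Q.IsPrime› h0) with h | h
    · exact absurd (Ideal.eq_top_of_isUnit_mem _ h hC2) (Ideal.IsPrime.ne_top ‹_›)
    · exact h
  have hX1 : (X 1 : (MvPolynomial (Fin 2) k)) ∈ Q := by
    rcases (Ideal.IsPrime.mem_or_mem ‹Q.IsPrime› h1) with h | h
    · exact absurd (Ideal.eq_top_of_isUnit_mem _ h hC3) (Ideal.IsPrime.ne_top ‹_›)
    · exact Ideal.IsPrime.mem_of_pow_mem ‹_› 2 h
  have hle : originIdeal k ≤ Q := originIdeal_le_of_X_mem k (fun i => by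
    fin_cases i
    · exact hX0
    · exact hX1)
  exact hP ((isMaximal_originIdeal k).eq_of_le (Ideal.IsPrime.ne_top ‹_›) hle).symm

/-- **The origin is a singular point of the cusp.** [folklore] -/
private theorem not_isRegularLocalRing_origin
    (P : Ideal ((MvPolynomial (Fin 2) k) ⧸ Ideal.span {cuspPoly k})) [P.IsPrime]
    (hP : P.comap (Ideal.Quotient.mk (Ideal.span {cuspPoly k})) = originIdeal k) :
    ¬ IsRegularLocalRing (Localization.AtPrime P) := by
  classical
  refine not_isRegularLocalRing_localization_of_pderiv_eval_eq_zero (0 : Fin 2 → k)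
    (cuspPoly_ne_zero k) ?_ ?_ P hP
  · simp [cuspPoly]
  · intro i
    fin_cases i
    · simp [pderiv_zero_cuspPoly]
    · simp [pderiv_one_cuspPoly]

/-! ## §B The affine plane, the cusp and its points -/

/-- The affine plane `Z = Spec k[x₀, x₁]`. [folklore] -/
private abbrev plane : Scheme.{u} := Spec (.of (MvPolynomial (Fin 2) k))

/-- The origin `s = (x₀, x₁)`, as a prime. [folklore] -/
private def originPt : PrimeSpectrum (MvPolynomial (Fin 2) k) := ⟨originIdeal k, (isMaximal_originIdeal k).isPrime⟩

/-- The generic point `η_T = (f)` of the cusp, as a prime. [folklore] -/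
private def cuspGenPt : PrimeSpectrum (MvPolynomial (Fin 2) k) := ⟨Ideal.span {cuspPoly k}, isPrime_span_cuspPoly k⟩

/-- The origin as a point of the plane. [folklore] -/
private def origin : plane k := originPt k

/-- The generic point of the cusp as a point of the plane. [folklore] -/
private def cuspGen : plane k := cuspGenPt k

/-- The prime ideal of the point `origin` is `𝔪₀`. [folklore] -/
@[simp] private theorem origin_asIdeal : (origin k).asIdeal = originIdeal k := rfl

/-- The prime ideal of the point `cuspGen` is `(f)`. [folklore] -/
@[simp] private theorem cuspGen_asIdeal : (cuspGen k).asIdeal = Ideal.span {cuspPoly k} := rfl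

/-- The cusp `T = cl{η_T} = V(f)` as a closed subset of the plane. [folklore] -/
private def cuspSet : Closeds (plane k) := ⟨closure {cuspGen k}, isClosed_closure⟩

/-- `ξ ⤳ z` iff `f ∈ 𝔭_z`. [folklore] -/
private theorem cuspGen_specializes_iff (z : plane k) : cuspGen k ⤳ z ↔ cuspPoly k ∈ z.asIdeal := by
  have h := PrimeSpectrum.le_iff_specializes (cuspGenPt k) z
  change _ ↔ cuspGen k ⤳ z at h
  rw [← h]
  change Ideal.span {cuspPoly k} ≤ z.asIdeal ↔ _
  rw [Ideal.span_singleton_le_iff_mem]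

/-- `z ∈ X` iff `f ∈ 𝔭_z`. [folklore] -/
private theorem mem_cuspSet_iff (z : plane k) : z ∈ cuspSet k ↔ cuspPoly k ∈ z.asIdeal := by
  have h := PrimeSpectrum.le_iff_mem_closure (cuspGenPt k) z
  change _ ↔ z ∈ cuspSet k at h
  rw [← h]
  change Ideal.span {cuspPoly k} ≤ z.asIdeal ↔ _
  rw [Ideal.span_singleton_le_iff_mem]

/-- `z ∈ X` iff `ξ ⤳ z`. [folklore] -/
private theorem mem_cuspSet_iff_specializes (z : plane k) : z ∈ cuspSet k ↔ cuspGen k ⤳ z := by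
  rw [mem_cuspSet_iff, cuspGen_specializes_iff]

/-- `ξ ⤳ s`. [folklore] -/
private theorem cuspGen_specializes_origin : cuspGen k ⤳ origin k :=
  (cuspGen_specializes_iff k _).mpr (cuspPoly_mem_originIdeal k)

/-- `s ∈ X`. [folklore] -/
private theorem origin_mem_cuspSet : origin k ∈ cuspSet k :=
  (mem_cuspSet_iff k _).mpr (cuspPoly_mem_originIdeal k)

/-- `ξ ∈ X`. [folklore] -/
private theorem cuspGen_mem_cuspSet : cuspGen k ∈ cuspSet k := subset_closure rfl

/-- `xᵢ ∉ (f)`. [folklore] -/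
private theorem X_notMem_span_cuspPoly (i : Fin 2) : (X i : (MvPolynomial (Fin 2) k)) ∉ Ideal.span {cuspPoly k} := by
  intro hX
  rw [Ideal.mem_span_singleton] at hX
  have h := totalDegree_le_of_dvd_of_isDomain hX (X_ne_zero i)
  rw [totalDegree_X] at h
  -- `totalDegree f ≥ 3`
  have h3 : 3 ≤ (cuspPoly k).totalDegree := by
    classical
    have hm : (Finsupp.single (1 : Fin 2) 3) ∈ (cuspPoly k).support := by
      rw [MvPolynomial.mem_support_iff, cuspPoly, coeff_sub, coeff_X_pow, coeff_X_pow]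
      simp [Finsupp.single_eq_single_iff]
    have := le_totalDegree hm
    simpa using this
  omega

/-- `ξ ≠ s`. [folklore] -/
private theorem cuspGen_ne_origin : cuspGen k ≠ origin k := by
  intro h
  have h' : Ideal.span {cuspPoly k} = originIdeal k := congrArg PrimeSpectrum.asIdeal h
  exact X_notMem_span_cuspPoly k 0 (h' ▸ X_mem_originIdeal k 0)

/-- The `A`-algebra structure on a stalk of `Spec A` (Mathlib `StructureSheaf.stalkAlgebra`). [folklore] -/
private abbrev stalkAlg (z : plane k) : Algebra (MvPolynomial (Fin 2) k) ((plane k).presheaf.stalk z) :=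
  (StructureSheaf.toStalk (MvPolynomial (Fin 2) k) z).hom.toAlgebra

/-- The stalk `𝒪_{Z,z}` is the localisation of `k[x₀, x₁]` at `𝔭_z` (Mathlib `StructureSheaf.stalkIso`). [folklore] -/
private theorem isLocalization_stalk (z : plane k) :
    @IsLocalization.AtPrime (MvPolynomial (Fin 2) k) _ ((plane k).presheaf.stalk z) _ (stalkAlg k z) z.asIdeal _ :=
  StructureSheaf.IsLocalization.to_stalk (MvPolynomial (Fin 2) k) z

/-- The contraction to `A` of the prime `𝔭_η ⊂ 𝒪_{Z,z}` of the generisation `η_T ⤳ z` is `(f)`. [folklore] -/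
private theorem comap_primeOfSpecializes_cuspGen (z : plane k) (hz : cuspGen k ⤳ z) :
    (primeOfSpecializes hz).comap (StructureSheaf.toStalk (MvPolynomial (Fin 2) k) z).hom = Ideal.span {cuspPoly k} := by
  letI := stalkAlg k (cuspGen k)
  haveI : IsLocalization.AtPrime ((plane k).presheaf.stalk (cuspGen k)) (cuspGen k).asIdeal :=
    isLocalization_stalk k (cuspGen k)
  have hcomp : StructureSheaf.toStalk (MvPolynomial (Fin 2) k) z ≫ (plane k).presheaf.stalkSpecializes hz =
      StructureSheaf.toStalk (MvPolynomial (Fin 2) k) (cuspGen k) :=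
    StructureSheaf.toStalk_stalkSpecializes hz
  have h1 : (primeOfSpecializes hz).comap (StructureSheaf.toStalk (MvPolynomial (Fin 2) k) z).hom =
      (maximalIdeal ((plane k).presheaf.stalk (cuspGen k))).comap
        (StructureSheaf.toStalk (MvPolynomial (Fin 2) k) (cuspGen k)).hom := by
    change ((maximalIdeal ((plane k).presheaf.stalk (cuspGen k))).comap
      ((plane k).presheaf.stalkSpecializes hz).hom).comap (StructureSheaf.toStalk (MvPolynomial (Fin 2) k) z).hom =
      (maximalIdeal ((plane k).presheaf.stalk (cuspGen k))).comap
        (StructureSheaf.toStalk (MvPolynomial (Fin 2) k) (cuspGen k)).hom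
    ext a
    simp only [Ideal.mem_comap]
    have ha : ((plane k).presheaf.stalkSpecializes hz).hom ((StructureSheaf.toStalk (MvPolynomial (Fin 2) k) z).hom a) =
        (StructureSheaf.toStalk (MvPolynomial (Fin 2) k) (cuspGen k)).hom a := by
      rw [← hcomp]; rfl
    erw [ha]
    exact Iff.rfl
  rw [h1]
  have h2 := IsLocalization.AtPrime.under_maximalIdeal ((plane k).presheaf.stalk (cuspGen k))
    (cuspGen k).asIdeal
  rw [Ideal.under_def] at h2
  exact h2

/-- **The germ of the ideal of the cusp at a point `z ∈ T` is `f · 𝒪_{Z,z}`.** [folklore] -/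
private theorem stalkIdeal_cuspSet_eq (z : plane k) (hz : cuspGen k ⤳ z) :
    stalkIdeal (vanishingIdeal (cuspSet k)) z =
      (Ideal.span {cuspPoly k}).map (StructureSheaf.toStalk (MvPolynomial (Fin 2) k) z).hom := by
  letI := stalkAlg k z
  haveI : IsLocalization.AtPrime ((plane k).presheaf.stalk z) z.asIdeal := isLocalization_stalk k z
  change _ = (Ideal.span {cuspPoly k}).map (algebraMap (MvPolynomial (Fin 2) k) ((plane k).presheaf.stalk z))
  have hu : (primeOfSpecializes hz).under (MvPolynomial (Fin 2) k) = Ideal.span {cuspPoly k} :=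
    comap_primeOfSpecializes_cuspGen k z hz
  rw [show cuspSet k = ⟨closure {cuspGen k}, isClosed_closure⟩ from rfl,
    stalkIdeal_vanishingIdeal_closure hz, ← hu,
    IsLocalization.map_under z.asIdeal.primeCompl ((plane k).presheaf.stalk z)]

/-! ## §B2 Regular and singular points of the cusp, read on the stalks of the plane -/

/-- The prime `𝔭/(f)` of `A/(f)` under a point `𝔭 ∋ f` of the cusp. [folklore] -/
private def cuspQuotPt (z : plane k) (hz : cuspPoly k ∈ z.asIdeal) : PrimeSpectrum ((MvPolynomial (Fin 2) k) ⧸ (Ideal.span {cuspPoly k})) :=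
  ⟨z.asIdeal.map (Ideal.Quotient.mk (Ideal.span {cuspPoly k})),
    Ideal.map_isPrime_of_surjective Ideal.Quotient.mk_surjective
      (by rw [Ideal.mk_ker, Ideal.span_singleton_le_iff_mem]; exact hz)⟩

/-- The point of `Spec k[x₀,x₁]/(f)` under `z ∈ X` contracts to `𝔭_z`. [folklore] -/
private theorem comap_cuspQuotPt (z : plane k) (hz : cuspPoly k ∈ z.asIdeal) :
    (cuspQuotPt k z hz).asIdeal.comap (Ideal.Quotient.mk (Ideal.span {cuspPoly k})) = z.asIdeal := by
  change (z.asIdeal.map (Ideal.Quotient.mk (Ideal.span {cuspPoly k}))).comap (Ideal.Quotient.mk (Ideal.span {cuspPoly k})) = z.asIdeal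
  rw [Ideal.comap_map_of_surjective _ Ideal.Quotient.mk_surjective, sup_eq_left]
  intro a ha
  rw [Ideal.mem_comap, Ideal.mem_bot, Ideal.Quotient.eq_zero_iff_mem,
    Ideal.mem_span_singleton] at ha
  obtain ⟨b, rfl⟩ := ha
  exact z.asIdeal.mul_mem_right b hz

/-- **Dictionary**: the reduced structure of the cusp at `z` is regular iff the local ring
`(A/(f))_{𝔭_z/(f)}` is regular. [folklore] -/
private theorem isRegularLocalRing_stalk_quotient_iff (z : plane k) (hz : cuspPoly k ∈ z.asIdeal) :
    IsRegularLocalRing ((plane k).presheaf.stalk z ⧸ stalkIdeal (vanishingIdeal (cuspSet k)) z) ↔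
      IsRegularLocalRing (Localization.AtPrime (cuspQuotPt k z hz).asIdeal) := by
  letI := stalkAlg k z
  haveI hloc : IsLocalization.AtPrime ((plane k).presheaf.stalk z) z.asIdeal :=
    isLocalization_stalk k z
  rw [stalkIdeal_cuspSet_eq k z ((cuspGen_specializes_iff k z).mpr hz)]
  change IsRegularLocalRing ((plane k).presheaf.stalk z ⧸
    (Ideal.span {cuspPoly k}).map (algebraMap (MvPolynomial (Fin 2) k) ((plane k).presheaf.stalk z))) ↔ _
  have hPQ : (cuspQuotPt k z hz).asIdeal.comap (Ideal.Quotient.mk (Ideal.span {cuspPoly k})) = z.asIdeal :=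
    comap_cuspQuotPt k z hz
  have hsub : Algebra.algebraMapSubmonoid ((MvPolynomial (Fin 2) k) ⧸ (Ideal.span {cuspPoly k})) z.asIdeal.primeCompl =
      (cuspQuotPt k z hz).asIdeal.primeCompl := by
    ext x
    constructor
    · rintro ⟨c, hc, rfl⟩
      intro hx
      apply hc
      rw [← hPQ]
      exact hx
    · intro hx
      obtain ⟨c, rfl⟩ := Ideal.Quotient.mk_surjective x
      refine ⟨c, fun hc => hx ?_, rfl⟩
      rw [← hPQ] at hc
      exact hc
  haveI : IsLocalization.AtPrime ((plane k).presheaf.stalk z ⧸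
      (Ideal.span {cuspPoly k}).map (algebraMap (MvPolynomial (Fin 2) k) ((plane k).presheaf.stalk z))) (cuspQuotPt k z hz).asIdeal := by
    change IsLocalization (cuspQuotPt k z hz).asIdeal.primeCompl _
    rw [← hsub]
    infer_instance
  let e : ((plane k).presheaf.stalk z ⧸ (Ideal.span {cuspPoly k}).map (algebraMap (MvPolynomial (Fin 2) k) ((plane k).presheaf.stalk z)))
      ≃ₐ[(MvPolynomial (Fin 2) k) ⧸ (Ideal.span {cuspPoly k})] Localization.AtPrime (cuspQuotPt k z hz).asIdeal :=
    IsLocalization.algEquiv (cuspQuotPt k z hz).asIdeal.primeCompl _ _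
  exact ⟨fun h => @IsRegularLocalRing.of_ringEquiv _ _ h _ _ e.toRingEquiv,
    fun h => @IsRegularLocalRing.of_ringEquiv _ _ h _ _ e.toRingEquiv.symm⟩

/-- **Away from the origin the reduced cusp is regular** (`char k = 0`). [folklore] -/
private theorem isRegularLocalRing_stalk_quotient_of_ne [CharZero k] (z : plane k)
    (hz : cuspPoly k ∈ z.asIdeal) (hne : z ≠ origin k) :
    IsRegularLocalRing ((plane k).presheaf.stalk z ⧸ stalkIdeal (vanishingIdeal (cuspSet k)) z) := by
  rw [isRegularLocalRing_stalk_quotient_iff k z hz]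
  apply isRegularLocalRing_of_ne_origin k
  rw [comap_cuspQuotPt]
  intro h
  exact hne (PrimeSpectrum.ext h)

/-- **At the origin the reduced cusp is not regular.** [folklore] -/
private theorem not_isRegularLocalRing_stalk_quotient_origin :
    ¬ IsRegularLocalRing ((plane k).presheaf.stalk (origin k) ⧸
      stalkIdeal (vanishingIdeal (cuspSet k)) (origin k)) := by
  rw [isRegularLocalRing_stalk_quotient_iff k (origin k) (cuspPoly_mem_originIdeal k)]
  exact not_isRegularLocalRing_origin k _ (comap_cuspQuotPt k _ _)

/-! ## §D1 Transport of "the reduced structure is regular at a point" along open immersions -/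

/-- For an open immersion `j : U → X`, a closed `S ⊆ X` and `y ∈ U`: the reduced structure on
`j⁻¹ S` is regular at `y` iff the reduced structure on `S` is regular at `j y`. [folklore] -/
private theorem isRegularLocalRing_quotient_iff_of_isOpenImmersion {U X : Scheme.{u}} (j : U ⟶ X)
    [IsOpenImmersion j] (S : Closeds X) (y : U) :
    IsRegularLocalRing (U.presheaf.stalk y ⧸
        stalkIdeal (vanishingIdeal (S.preimage j.continuous)) y) ↔
      IsRegularLocalRing (X.presheaf.stalk (j y) ⧸ stalkIdeal (vanishingIdeal S) (j y)) := by
  rw [← comap_vanishingIdeal_of_isOpenImmersion j S, stalkIdeal_comap_eq_map_stalkMap]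
  let e : X.presheaf.stalk (j y) ≃+* U.presheaf.stalk y :=
    (asIso (j.stalkMap y)).commRingCatIsoToRingEquiv
  let e' : X.presheaf.stalk (j y) ⧸ stalkIdeal (vanishingIdeal S) (j y) ≃+*
      U.presheaf.stalk y ⧸ (stalkIdeal (vanishingIdeal S) (j y)).map (j.stalkMap y).hom :=
    Ideal.quotientEquiv _ _ e rfl
  exact ⟨fun h => @IsRegularLocalRing.of_ringEquiv _ _ h _ _ e'.symm,
    fun h => @IsRegularLocalRing.of_ringEquiv _ _ h _ _ e'⟩

/-! ## §B3 The summit-side hypotheses for the cusp in the plane -/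

/-- The cusp as a scheme, `X = Spec k[x₀,x₁]/(f)`. [folklore] -/
private abbrev cuspScheme : Scheme.{u} := Spec (.of ((MvPolynomial (Fin 2) k) ⧸ (Ideal.span {cuspPoly k})))

/-- The closed immersion `i : X → Z`. [folklore] -/
private abbrev cuspImm : cuspScheme k ⟶ plane k := Spec.map (CommRingCat.ofHom (Ideal.Quotient.mk (Ideal.span {cuspPoly k})))

/-- `i : X → Z` is a closed immersion. [folklore] -/
private theorem isClosedImmersion_cuspImm : IsClosedImmersion (cuspImm k) :=
  IsClosedImmersion.spec_of_surjective _ Ideal.Quotient.mk_surjective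

/-- `X = Spec k[x₀,x₁]/(f)` is reduced (indeed integral). [folklore] -/
private theorem isReduced_cuspScheme : IsReduced (cuspScheme k) := by
  haveI : (Ideal.span {cuspPoly k}).IsPrime := isPrime_span_cuspPoly k
  haveI : IsDomain ((MvPolynomial (Fin 2) k) ⧸ (Ideal.span {cuspPoly k})) := Ideal.Quotient.isDomain (Ideal.span {cuspPoly k})
  haveI : _root_.IsReduced (CommRingCat.of ((MvPolynomial (Fin 2) k) ⧸ (Ideal.span {cuspPoly k}))) := inferInstanceAs (_root_.IsReduced ((MvPolynomial (Fin 2) k) ⧸ (Ideal.span {cuspPoly k})))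
  infer_instance

/-- `Z = 𝔸²_k` is Noetherian. [folklore] -/
private theorem isNoetherian_plane : IsNoetherian (plane k) := inferInstance

/-- `Z = 𝔸²_k` is regular (Mathlib: polynomial rings over a field are regular). [folklore] -/
private theorem isRegular_plane : Scheme.IsRegular (plane k) := by
  haveI : IsRegularRing (CommRingCat.of (MvPolynomial (Fin 2) k)) := inferInstanceAs (IsRegularRing (MvPolynomial (Fin 2) k))
  exact Scheme.isRegular_Spec _

/-- `Z = 𝔸²_k` is excellent (finite type over a field, `ExcellentRingsFieldProofs`). [folklore] -/
private theorem isExcellent_plane : Scheme.IsExcellent (plane k) :=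
  Scheme.isExcellent_Spec_of_isExcellentRing (MvPolynomial (Fin 2) k) (isExcellentRing_of_finiteType_field k (MvPolynomial (Fin 2) k))

/-- `i(X) = V(f)` is the closure of `ξ`. [folklore] -/
private theorem range_cuspImm : Set.range (cuspImm k) = (cuspSet k : Set (plane k)) := by
  have h1 : Set.range (cuspImm k) =
      (PrimeSpectrum.zeroLocus ((Ideal.span {cuspPoly k}) : Set (MvPolynomial (Fin 2) k)) : Set (PrimeSpectrum (MvPolynomial (Fin 2) k))) := by
    have := range_comap_of_surjective ((MvPolynomial (Fin 2) k) ⧸ (Ideal.span {cuspPoly k})) (Ideal.Quotient.mk (Ideal.span {cuspPoly k}))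
      Ideal.Quotient.mk_surjective
    rw [Ideal.mk_ker] at this
    rw [← this]
    rfl
  rw [h1]
  change _ = closure {(cuspGenPt k : PrimeSpectrum (MvPolynomial (Fin 2) k))}
  rw [PrimeSpectrum.closure_singleton, cuspGenPt, PrimeSpectrum.zeroLocus_span]

/-- `dim X ≤ 2` (indeed `= 1`; `≤ dim k[x₀,x₁] = 2` suffices). [folklore] -/
private theorem topologicalKrullDim_cuspScheme : topologicalKrullDim (cuspScheme k) ≤ 2 := by
  change topologicalKrullDim (PrimeSpectrum ((MvPolynomial (Fin 2) k) ⧸ (Ideal.span {cuspPoly k}))) ≤ 2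
  rw [PrimeSpectrum.topologicalKrullDim_eq_ringKrullDim]
  calc ringKrullDim ((MvPolynomial (Fin 2) k) ⧸ (Ideal.span {cuspPoly k})) ≤ ringKrullDim (MvPolynomial (Fin 2) k) := ringKrullDim_quotient_le (Ideal.span {cuspPoly k})
    _ = 2 := by exact_mod_cast ringKrullDim_mvPolynomial_fin_eq k 2

/-! ## §C The blow-up of the plane at the origin, read at a point over the origin on the strict transform of the cusp -/

/-- The origin is a closed point of `Z`. [folklore] -/
private theorem isClosed_origin : IsClosed ({origin k} : Set (plane k)) :=
  (PrimeSpectrum.isClosed_singleton_iff_isMaximal (originPt k)).mpr (isMaximal_originIdeal k)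

/-- The ideal sheaf `𝔪_s` of the (reduced) origin. [folklore] -/
private def originSheaf : (plane k).IdealSheafData := vanishingIdeal ⟨{origin k}, isClosed_origin k⟩

/-- `supp 𝔪_s = {s}`. [folklore] -/
private theorem coe_support_originSheaf : ((originSheaf k).support : Set (plane k)) = {origin k} := by
  rw [originSheaf, coe_support_vanishingIdeal]; rfl

/-- `𝔪₀ = (x₀, x₁)`. [folklore] -/
private theorem originIdeal_eq_span_range : originIdeal k = Ideal.span (Set.range (X : Fin 2 → (MvPolynomial (Fin 2) k))) := by
  apply le_antisymm
  · exact originIdeal_le_of_X_mem k (fun i => Ideal.subset_span ⟨i, rfl⟩)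
  · rw [Ideal.span_le]
    rintro _ ⟨i, rfl⟩
    exact X_mem_originIdeal k i

/-- The germs `x_j ∈ 𝒪_{Z,x}` of the coordinates. [folklore] -/
private def germX (x : plane k) (j : Fin 2) : (plane k).presheaf.stalk x :=
  (StructureSheaf.toStalk (MvPolynomial (Fin 2) k) x).hom (X j)

/-- At (a point equal to) the origin, the germs of `x₀, x₁` generate the stalk of `𝔪_s`. [folklore] -/
private theorem span_range_germX {x : plane k} (hx : x = origin k) :
    Ideal.span (Set.range (germX k x)) = stalkIdeal (originSheaf k) x := by
  subst hx
  letI := stalkAlg k (origin k)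
  haveI : IsLocalization.AtPrime ((plane k).presheaf.stalk (origin k)) (origin k).asIdeal :=
    isLocalization_stalk k _
  rw [originSheaf, stalkIdeal_vanishingIdeal_singleton, ← IsLocalization.AtPrime.map_eq_maximalIdeal
    (origin k).asIdeal ((plane k).presheaf.stalk (origin k)), origin_asIdeal,
    originIdeal_eq_span_range, Ideal.map_span, ← Set.range_comp]
  rfl

/-- At (a point equal to) the origin, the stalk of `𝔪_s` is the maximal ideal. [folklore] -/
private theorem stalkIdeal_originSheaf {x : plane k} (hx : x = origin k) :
    stalkIdeal (originSheaf k) x = maximalIdeal ((plane k).presheaf.stalk x) := by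
  subst hx
  exact stalkIdeal_vanishingIdeal_singleton (isClosed_origin k)

/-- The stalks of the plane at (a point equal to) the origin are two-dimensional. [folklore] -/
private theorem ringKrullDim_stalk_origin {x : plane k} (hx : x = origin k) :
    ringKrullDim ((plane k).presheaf.stalk x) = 2 := by
  subst hx
  letI := stalkAlg k (origin k)
  haveI : IsLocalization.AtPrime ((plane k).presheaf.stalk (origin k)) (origin k).asIdeal :=
    isLocalization_stalk k _
  haveI : (originIdeal k).IsMaximal := isMaximal_originIdeal k
  rw [IsLocalization.AtPrime.ringKrullDim_eq_height (origin k).asIdeal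
    ((plane k).presheaf.stalk (origin k)), origin_asIdeal, MvPolynomial.height_eq_of_isMaximal k 2]
  rfl

/-- The germ of `f` at a point of the plane (typed in the stalk of the scheme `𝔸²`). [folklore] -/
private def germF (x : plane k) : (plane k).presheaf.stalk x :=
  (StructureSheaf.toStalk (MvPolynomial (Fin 2) k) x).hom (cuspPoly k)

/-- The germ of `f` is `x₀² − x₁³` in the germs of the coordinates. [folklore] -/
private theorem germF_eq (x : plane k) : germF k x = germX k x 0 ^ 2 - germX k x 1 ^ 3 := by
  have h : (StructureSheaf.toStalk (MvPolynomial (Fin 2) k) x).hom (cuspPoly k) =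
      (StructureSheaf.toStalk (MvPolynomial (Fin 2) k) x).hom (X 0) ^ 2 -
        (StructureSheaf.toStalk (MvPolynomial (Fin 2) k) x).hom (X 1) ^ 3 := by
    rw [cuspPoly, map_sub, map_pow, map_pow]
  exact h

/-- At a point `y ⤳ x` equal to the generic point of the cusp, `𝔭_y` contracts to `(f)`. [folklore] -/
private theorem comap_primeOfSpecializes_of_eq_cuspGen {x y : plane k} (hy : y ⤳ x) (h : y = cuspGen k) :
    (primeOfSpecializes hy).comap (StructureSheaf.toStalk (MvPolynomial (Fin 2) k) x).hom = Ideal.span {cuspPoly k} := by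
  subst h
  exact comap_primeOfSpecializes_cuspGen k x hy

variable {k}

/-- **Naturality of `𝔭_η` under morphisms**: for `f : X → Y` and `x ⤳ x'`,
`(f^♯_{x'})⁻¹ 𝔭_x = 𝔭_{f x}`. [folklore] -/
private theorem comap_stalkMap_primeOfSpecializes {X Y : Scheme.{u}} (f : X ⟶ Y) {x x' : X} (h : x ⤳ x') :
    (primeOfSpecializes h).comap (f.stalkMap x').hom =
      primeOfSpecializes (f.base.hom.map_specializes h) := by
  change ((maximalIdeal (X.presheaf.stalk x)).comap (X.presheaf.stalkSpecializes h).hom).comap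
      (f.stalkMap x').hom =
    (maximalIdeal (Y.presheaf.stalk (f x))).comap
      (Y.presheaf.stalkSpecializes (f.base.hom.map_specializes h)).hom
  rw [← IsLocalRing.maximalIdeal_comap (f.stalkMap x).hom, Ideal.comap_comap, Ideal.comap_comap,
    ← CommRingCat.hom_comp, ← CommRingCat.hom_comp, Scheme.Hom.stalkSpecializes_stalkMap]

set_option maxHeartbeats 800000 in -- one chart-to-stalk unification, as in `HypersurfaceMaxOrderTransform.lean`
/-- **Chart core.** Let `π : Z₁ → Z` be a blow-up of the plane along `𝔪_s`, `P ∈ Z₁` a point over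
the origin `s` and `η' ⤳ P` a generisation of `P` lying over the generic point of the cusp. Then,
reading `𝒪_{Z₁,P}` through the `x₁`-chart of the blow-up (`x₀ = x₁ t`), there are
`a = x₁, b = t ∈ 𝒪_{Z₁,P}` with: `(a, b)` a regular system of parameters of the
two-dimensional regular local ring `𝒪_{Z₁,P}`; the prime `𝔭_{η'}` contains `b² − a` but
not `a`; the pull-back of `f` is `a² (b² − a)`; and the pull-back of `𝔪_s` has stalk `(a)`. [folklore] -/
private theorem chart_core {Z₁ : Scheme.{u}} {π : Z₁ ⟶ plane k} (hπ : IsBlowup π (originSheaf k))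
    (P : Z₁) (hP : π P = origin k) (η' : Z₁) (hη : π η' = cuspGen k) (hsp : η' ⤳ P) :
    ∃ a b : Z₁.presheaf.stalk P,
      IsRsopPart ![a, b] ∧ ringKrullDim (Z₁.presheaf.stalk P) = 2 ∧
      Ideal.span {a, b} = maximalIdeal (Z₁.presheaf.stalk P) ∧
      a ∉ primeOfSpecializes hsp ∧ b ^ 2 - a ∈ primeOfSpecializes hsp ∧
      (π.stalkMap P).hom (germF k (π P)) = a ^ 2 * (b ^ 2 - a) ∧
      stalkIdeal ((originSheaf k).comap π) P = Ideal.span {a} := by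
  classical
  -- the base local ring `R = 𝒪_{Z,s}` and the generators `c = (x₀, x₁)` of `𝔪_s`
  haveI hRreg : IsRegularLocalRing ((plane k).presheaf.stalk (π P)) := isRegular_plane k (π P)
  have hc : Ideal.span (Set.range (germX k (π P))) = stalkIdeal (originSheaf k) (π P) :=
    span_range_germX k hP
  have hmaxR := stalkIdeal_originSheaf k hP
  have hzR : Ideal.span (Set.range (Fin.append (germX k (π P))
      (Fin.elim0 : Fin 0 → (plane k).presheaf.stalk (π P)))) =
      maximalIdeal ((plane k).presheaf.stalk (π P)) := by
    rw [← hmaxR, ← hc]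
    congr 1
    ext r
    constructor
    · rintro ⟨i, rfl⟩
      refine Fin.addCases (fun j => ?_) (fun j => j.elim0) i
      exact ⟨j, by simp⟩
    · rintro ⟨j, rfl⟩
      exact ⟨Fin.castAdd 0 j, by simp⟩
  have hdimR : ringKrullDim ((plane k).presheaf.stalk (π P)) = 2 := ringKrullDim_stalk_origin k hP
  have hd : (maximalIdeal ((plane k).presheaf.stalk (π P))).spanFinrank = 2 + 0 := by
    have h := IsRegularLocalRing.spanFinrank_maximalIdeal (R := (plane k).presheaf.stalk (π P))
    rw [hdimR] at h
    exact_mod_cast h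
  have hcmem : ∀ j, germX k (π P) j ∈ maximalIdeal ((plane k).presheaf.stalk (π P)) := fun j =>
    hzR ▸ Ideal.subset_span ⟨Fin.castAdd 0 j, by simp⟩
  -- the chart at `P`
  obtain ⟨j, 𝔴, χ, hχ, hlocL, h𝔴⟩ := hπ.exists_reesChart_stalk P (germX k (π P)) hc
  letI := χ.toAlgebra
  haveI := hlocL
  have halg : (algebraMap (chartRing (germX k (π P)) j) (Z₁.presheaf.stalk P) : _ →+* _) = χ :=
    RingHom.algebraMap_toAlgebra χ
  have hfR : (π.stalkMap P).hom (germF k (π P)) =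
      (π.stalkMap P).hom (germX k (π P) 0 ^ 2 - germX k (π P) 1 ^ 3) :=
    congrArg _ (germF_eq k (π P))
  -- everything is read in `L = 𝒪_{Z₁,P}`; `u i` = the image of `x_i`
  obtain ⟨u, hu⟩ : ∃ u : Fin 2 → Z₁.presheaf.stalk P,
      u = fun i => (π.stalkMap P).hom (germX k (π P) i) := ⟨_, rfl⟩
  have huf : (π.stalkMap P).hom (germF k (π P)) = u 0 ^ 2 - u 1 ^ 3 := by
    rw [hfR, map_sub, map_pow, map_pow, hu]
  -- `f ∈ 𝔭_{η'}`, `x_i ∉ 𝔭_{η'}`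
  have hsp' : π η' ⤳ π P := π.base.hom.map_specializes hsp
  have hcomapA : (primeOfSpecializes hsp').comap (StructureSheaf.toStalk (MvPolynomial (Fin 2) k) (π P)).hom = (Ideal.span {cuspPoly k}) :=
    comap_primeOfSpecializes_of_eq_cuspGen k hsp' hη
  have hcomapL : (primeOfSpecializes hsp).comap (π.stalkMap P).hom = primeOfSpecializes hsp' :=
    comap_stalkMap_primeOfSpecializes π hsp
  have hfq : (π.stalkMap P).hom (germF k (π P)) ∈ primeOfSpecializes hsp := by
    have h1 : cuspPoly k ∈ (primeOfSpecializes hsp').comap (StructureSheaf.toStalk (MvPolynomial (Fin 2) k) (π P)).hom := by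
      rw [hcomapA]; exact Ideal.subset_span rfl
    have h2 : germF k (π P) ∈ primeOfSpecializes hsp' := Ideal.mem_comap.mp h1
    rw [← hcomapL] at h2
    exact Ideal.mem_comap.mp h2
  have hXq : ∀ i, u i ∉ primeOfSpecializes hsp := by
    intro i hi
    rw [hu] at hi
    have h3 : germX k (π P) i ∈ (primeOfSpecializes hsp).comap (π.stalkMap P).hom :=
      Ideal.mem_comap.mpr hi
    rw [hcomapL] at h3
    have h4 : (X i : (MvPolynomial (Fin 2) k)) ∈ (primeOfSpecializes hsp').comap (StructureSheaf.toStalk (MvPolynomial (Fin 2) k) (π P)).hom :=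
      Ideal.mem_comap.mpr h3
    rw [hcomapA] at h4
    exact X_notMem_span_cuspPoly k i h4
  have humem : ∀ i, u i ∈ maximalIdeal (Z₁.presheaf.stalk P) := by
    intro i
    rw [hu]
    exact map_nonunit (π.stalkMap P).hom _ (hcmem i)
  have hqle : primeOfSpecializes hsp ≤ maximalIdeal (Z₁.presheaf.stalk P) :=
    IsLocalRing.le_maximalIdeal (Ideal.IsPrime.ne_top inferInstance)
  -- the chart relation `x_i = x_j · e_i`, read in `L`
  have hrelL : ∀ i, u i = u j *
      (algebraMap (chartRing (germX k (π P)) j) (Z₁.presheaf.stalk P) : _ →+* _) (chartGen (germX k (π P)) j i) := by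
    intro i
    rw [hu, halg]
    change (π.stalkMap P).hom (germX k (π P) i) = (π.stalkMap P).hom (germX k (π P) j) * _
    rw [← hχ, ← hχ, ← map_mul, ← reesChartBase_apply_eq_mul_chartGen (germX k (π P)) j i]
  have he𝔴 : ∀ i, (algebraMap (chartRing (germX k (π P)) j) (Z₁.presheaf.stalk P) : _ →+* _)
      (chartGen (germX k (π P)) j i) ∈ maximalIdeal (Z₁.presheaf.stalk P) →
      chartGen (germX k (π P)) j i ∈ 𝔴.asIdeal := fun i h =>
    (IsLocalization.AtPrime.to_map_mem_maximal_iff (Z₁.presheaf.stalk P) 𝔴.asIdeal _).mp h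
  -- the chart must be the `x₁`-chart
  have hj : j = 1 := by
    rcases Fin.exists_fin_two.mp ⟨j, rfl⟩ with h | h
    · exfalso
      -- in the `x₀`-chart, `x₁ = x₀ e` and `f = x₀² (1 - x₀ e³)`
      subst h
      obtain ⟨e, he⟩ : ∃ e : Z₁.presheaf.stalk P,
        e = (algebraMap (chartRing (germX k (π P)) 0) (Z₁.presheaf.stalk P) : _ →+* _)
          (chartGen (germX k (π P)) 0 1) := ⟨_, rfl⟩
      have h1 : u 1 = u 0 * e := by rw [he]; exact hrelL 1
      have hf0 : (π.stalkMap P).hom (germF k (π P)) = u 0 ^ 2 * (1 - u 0 * e ^ 3) := by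
        rw [huf, h1]; ring
      rw [hf0] at hfq
      rcases (Ideal.IsPrime.mem_or_mem inferInstance hfq) with h | h
      · exact hXq 0 (Ideal.IsPrime.mem_of_pow_mem inferInstance 2 h)
      · have h3 : u 0 * e ^ 3 ∈ maximalIdeal (Z₁.presheaf.stalk P) :=
          Ideal.mul_mem_right _ _ (humem 0)
        have h4 := Ideal.add_mem _ (hqle h) h3
        rw [sub_add_cancel] at h4
        exact (maximalIdeal.isMaximal (Z₁.presheaf.stalk P)).ne_top ((Ideal.eq_top_iff_one _).mpr h4)
    · exact h
  subst hj
  -- the `x₁`-chart: `a = x₁`, `b = t = x₀/x₁`, `f = a² (b² - a)`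
  obtain ⟨a, ha⟩ : ∃ a : Z₁.presheaf.stalk P, a = u 1 := ⟨_, rfl⟩
  obtain ⟨b, hb⟩ : ∃ b : Z₁.presheaf.stalk P,
    b = (algebraMap (chartRing (germX k (π P)) 1) (Z₁.presheaf.stalk P) : _ →+* _)
      (chartGen (germX k (π P)) 1 0) := ⟨_, rfl⟩
  have h0 : u 0 = a * b := by rw [ha, hb]; exact hrelL 0
  have hf1 : (π.stalkMap P).hom (germF k (π P)) = a ^ 2 * (b ^ 2 - a) := by
    rw [huf, h0, ha]; ring
  have hgq : b ^ 2 - a ∈ primeOfSpecializes hsp := by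
    rw [hf1] at hfq
    rcases (Ideal.IsPrime.mem_or_mem inferInstance hfq) with h | h
    · exact absurd (Ideal.IsPrime.mem_of_pow_mem inferInstance 2 h) (ha ▸ hXq 1)
    · exact h
  have hamem : a ∈ maximalIdeal (Z₁.presheaf.stalk P) := ha ▸ humem 1
  have hbmem : b ∈ maximalIdeal (Z₁.presheaf.stalk P) := by
    have h2 : b ^ 2 ∈ maximalIdeal (Z₁.presheaf.stalk P) := by
      have := Ideal.add_mem _ (hqle hgq) hamem
      rw [sub_add_cancel] at this
      exact this
    exact Ideal.IsPrime.mem_of_pow_mem inferInstance 2 h2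
  have ht𝔴 : chartGen (germX k (π P)) 1 0 ∈ 𝔴.asIdeal := he𝔴 0 (hb ▸ hbmem)
  -- the regular system of parameters `(a, b)` of `L`
  have hrsop := isRsopPart_chartFamily_reesChart (germX k (π P)) 1
    (Fin.elim0 : Fin 0 → (plane k).presheaf.stalk (π P)) hzR hd 𝔴.asIdeal h𝔴
    (Z₁.presheaf.stalk P) (a := 1) (fun _ => ⟨0, by decide⟩) (fun _ _ _ => Subsingleton.elim _ _)
    (fun _ => ht𝔴)
  have hfam : chartFamily (germX k (π P)) 1 (Fin.elim0 : Fin 0 → (plane k).presheaf.stalk (π P))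
      (Z₁.presheaf.stalk P) (chartBase (germX k (π P)) 1) (chartGen (germX k (π P)) 1)
      (fun _ : Fin 1 => (⟨0, by decide⟩ : {j : Fin 2 // j ≠ 1})) = ![a, b] := by
    funext i
    refine Fin.cases ?_ (fun i' => ?_) i
    · -- index 0: `x₁`
      rw [chartFamily, Fin.cons_zero, Matrix.cons_val_zero, ha, hu, halg, hχ]
    · -- index 1: `t`
      have : i' = 0 := Subsingleton.elim _ _
      subst this
      rw [chartFamily, Fin.cons_succ]
      change Fin.append _ _ (Fin.castAdd 0 (0 : Fin 1)) = _
      rw [Fin.append_left, hb]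
      rfl
  rw [hfam] at hrsop
  have hdimL_le : ringKrullDim (Z₁.presheaf.stalk P) ≤ 2 := by
    have := hπ.ringKrullDim_stalk_le P
    rw [hdimR] at this
    exact this
  obtain ⟨hregL, e, y, hdimL, hspanL⟩ := hrsop
  have he : e = 0 := by
    rw [hdimL] at hdimL_le
    have : (1 + 0 + 1 + e : ℕ) ≤ 2 := by exact_mod_cast hdimL_le
    omega
  subst he
  have hdimL2 : ringKrullDim (Z₁.presheaf.stalk P) = 2 := by rw [hdimL]; norm_num
  have hspan : Ideal.span {a, b} = maximalIdeal (Z₁.presheaf.stalk P) := by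
    rw [← hspanL, Set.range_eq_empty y, Set.union_empty, Matrix.range_cons_cons_empty]
  refine ⟨a, b, ⟨hregL, 0, y, hdimL, hspanL⟩, hdimL2, hspan, ha ▸ hXq 1, hgq, hf1, ?_⟩
  -- the pull-back of `𝔪_s`
  rw [stalkIdeal_comap_eq_map_stalkMap, ← hc, Ideal.map_span]
  apply le_antisymm
  · rw [Ideal.span_le]
    rintro _ ⟨_, ⟨i, rfl⟩, rfl⟩
    have hui : (π.stalkMap P).hom (germX k (π P) i) = u i := by rw [hu]
    rw [hui]
    rcases Fin.exists_fin_two.mp ⟨i, rfl⟩ with h | h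
    · rw [h, h0]
      exact Ideal.mul_mem_right _ _ (Ideal.subset_span rfl)
    · rw [h, ← ha]; exact Ideal.subset_span rfl
  · rw [Ideal.span_singleton_le_iff_mem, ha, hu]
    exact Ideal.subset_span ⟨germX k (π P) 1, ⟨1, rfl⟩, rfl⟩

/-! ## §M — over the origin the strict transform of the cusp is regular -/

/-- **Over the origin the strict transform is regular**: with `a, b` as in `chart_core`,
`𝔭_{η'} = (b² − a)` and `𝒪_{Z₁,P} ⧸ 𝔭_{η'}` is a regular local ring (of dimension one). [folklore] -/
private theorem isRegularLocalRing_quotient_of_over_origin {Z₁ : Scheme.{u}} {π : Z₁ ⟶ plane k}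
    (hπ : IsBlowup π (originSheaf k)) (P : Z₁) (hP : π P = origin k) (η' : Z₁)
    (hη : π η' = cuspGen k) (hsp : η' ⤳ P) :
    IsRegularLocalRing (Z₁.presheaf.stalk P ⧸
      stalkIdeal (vanishingIdeal ⟨closure {η'}, isClosed_closure⟩) P) := by
  classical
  obtain ⟨a, b, hrsop, hdim, hspan, haq, hgq, -, -⟩ := chart_core hπ P hP η' hη hsp
  haveI : IsRegularLocalRing (Z₁.presheaf.stalk P) := hrsop.1
  haveI : IsDomain (Z₁.presheaf.stalk P) := isDomain_of_isRegularLocalRing _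
  have hamem : a ∈ maximalIdeal (Z₁.presheaf.stalk P) :=
    hspan ▸ Ideal.subset_span (Set.mem_insert a {b})
  have hbmem : b ∈ maximalIdeal (Z₁.presheaf.stalk P) :=
    hspan ▸ Ideal.subset_span (Set.mem_insert_of_mem a rfl)
  have ha2 : a ∉ maximalIdeal (Z₁.presheaf.stalk P) ^ 2 := by
    simpa using hrsop.not_mem_sq 0
  have hg1 : b ^ 2 - a ∈ maximalIdeal (Z₁.presheaf.stalk P) :=
    Ideal.sub_mem _ (Ideal.pow_mem_of_mem _ hbmem 2 two_pos) hamem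
  have hg2 : b ^ 2 - a ∉ maximalIdeal (Z₁.presheaf.stalk P) ^ 2 := by
    intro h
    apply ha2
    have := Ideal.sub_mem _ (Ideal.pow_mem_pow hbmem 2) h
    rwa [sub_sub_cancel] at this
  obtain ⟨hregQ, hdimQ⟩ := IsRegularLocalRing.quotient_span_singleton hg1 hg2
  have hq : primeOfSpecializes hsp = Ideal.span {b ^ 2 - a} := by
    refine le_antisymm ?_ ((Ideal.span_singleton_le_iff_mem _).mpr hgq)
    haveI : IsDomain (Z₁.presheaf.stalk P ⧸ Ideal.span {b ^ 2 - a}) :=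
      isDomain_of_isRegularLocalRing _
    have hdim1 : ringKrullDim (Z₁.presheaf.stalk P ⧸ Ideal.span {b ^ 2 - a}) ≤ (1 : ℕ) := by
      obtain ⟨n, hn⟩ :=
        exists_nat_cast_eq_ringKrullDim (R := Z₁.presheaf.stalk P ⧸ Ideal.span {b ^ 2 - a})
      rw [hn, hdim] at hdimQ
      rw [hn]
      have h2 : n + 1 = 2 := by exact_mod_cast hdimQ
      have h1 : n ≤ 1 := by omega
      exact_mod_cast h1
    haveI : Ring.KrullDimLE 1 (Z₁.presheaf.stalk P ⧸ Ideal.span {b ^ 2 - a}) :=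
      Ring.krullDimLE_iff.mpr hdim1
    have hker : RingHom.ker (Ideal.Quotient.mk (Ideal.span {b ^ 2 - a})) ≤
        primeOfSpecializes hsp := by
      rw [Ideal.mk_ker]
      exact (Ideal.span_singleton_le_iff_mem _).mpr hgq
    have hprime : ((primeOfSpecializes hsp).map
        (Ideal.Quotient.mk (Ideal.span {b ^ 2 - a}))).IsPrime :=
      Ideal.map_isPrime_of_surjective Ideal.Quotient.mk_surjective hker
    by_cases hbot : (primeOfSpecializes hsp).map (Ideal.Quotient.mk (Ideal.span {b ^ 2 - a})) = ⊥
    · rw [Ideal.map_eq_bot_iff_le_ker, Ideal.mk_ker] at hbot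
      exact hbot
    · exfalso
      haveI hmax := hprime.isMaximal_of_ne_bot hbot
      have hcomap : ((primeOfSpecializes hsp).map
          (Ideal.Quotient.mk (Ideal.span {b ^ 2 - a}))).comap
            (Ideal.Quotient.mk (Ideal.span {b ^ 2 - a})) = primeOfSpecializes hsp := by
        rw [Ideal.comap_map_of_surjective _ Ideal.Quotient.mk_surjective,
          ← RingHom.ker_eq_comap_bot]
        exact sup_eq_left.mpr hker
      have hmax' : (primeOfSpecializes hsp).IsMaximal := by
        rw [← hcomap]
        exact Ideal.comap_isMaximal_of_surjective _ Ideal.Quotient.mk_surjective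
      apply haq
      rw [IsLocalRing.eq_maximalIdeal hmax']
      exact hamem
  rw [stalkIdeal_vanishingIdeal_closure hsp, hq]
  exact hregQ

/-! ## §E — over the origin the strict transform is tangent to the exceptional curve -/

/-- **No transversality over the origin.** For `D ∋ P, η'` inside `π⁻¹(X)` and `B ⊇ π⁻¹(s)`:
`D` is not transversal with `B` (at `P`): in `𝒪_{Z₁,P}` one has `I_D ≤ 𝔭_{η'} ∌ a`,
`0 ≠ π^* f ∈ I_D`, `I_B ≤ √(a) = (a)`, so a splitting `𝔪 = (z) + (w)`, `I_D = (z)`,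
`I_B = (∏_J w)` forces `r = e = 1` and `𝔪 ≤ 𝔭_{η'} + (a)`, which fails for `b`
(`b² − a ∈ 𝔭_{η'}`). [folklore] -/
private theorem not_isTransversalWith_of_over_origin {Z₁ : Scheme.{u}} {π : Z₁ ⟶ plane k}
    (hπ : IsBlowup π (originSheaf k)) (P : Z₁) (hP : π P = origin k) (η' : Z₁)
    (hη : π η' = cuspGen k) (hsp : η' ⤳ P) {D B : Set Z₁} (hPD : P ∈ D) (hηD : η' ∈ D)
    (hDT : D ⊆ π ⁻¹' (cuspSet k : Set (plane k))) (hEB : π ⁻¹' {origin k} ⊆ B) :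
    ¬ IsTransversalWith Z₁ D B := by
  classical
  intro hT
  obtain ⟨a, b, hrsop, hdim, hspan, haq, hgq, hf, hI⟩ := chart_core hπ P hP η' hη hsp
  obtain ⟨-, r, e, z, w, J, hdim', hzw, hID, hIB⟩ := hT P hPD
  haveI : IsRegularLocalRing (Z₁.presheaf.stalk P) := hrsop.1
  haveI : IsDomain (Z₁.presheaf.stalk P) := isDomain_of_isRegularLocalRing _
  have hamem : a ∈ maximalIdeal (Z₁.presheaf.stalk P) :=
    hspan ▸ Ideal.subset_span (Set.mem_insert a {b})
  have hbmem : b ∈ maximalIdeal (Z₁.presheaf.stalk P) :=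
    hspan ▸ Ideal.subset_span (Set.mem_insert_of_mem a rfl)
  have ha2 : a ∉ maximalIdeal (Z₁.presheaf.stalk P) ^ 2 := by
    simpa using hrsop.not_mem_sq 0
  have hap : Prime a := by simpa using hrsop.prime 0
  have hqle : primeOfSpecializes hsp ≤ maximalIdeal (Z₁.presheaf.stalk P) :=
    IsLocalRing.le_maximalIdeal (Ideal.IsPrime.ne_top inferInstance)
  -- (1) `I_D ≤ 𝔭_{η'}`
  have hDq : Ideal.span (Set.range z) ≤ primeOfSpecializes hsp := by
    rw [← hID]
    exact stalkIdeal_vanishingIdeal_le hsp (subset_closure hηD)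
  -- (2) `π^* f ∈ I_D` is non-zero, so `r ≠ 0`
  have hfD : (π.stalkMap P).hom (germF k (π P)) ∈ Ideal.span (Set.range z) := by
    rw [← hID]
    have h1 : stalkIdeal (vanishingIdeal ((cuspSet k).preimage π.continuous)) P ≤
        stalkIdeal (vanishingIdeal ⟨closure D, isClosed_closure⟩) P := by
      apply stalkIdeal_mono
      apply vanishingIdeal_antimono
      change closure D ⊆ π ⁻¹' (cuspSet k : Set (plane k))
      exact closure_minimal hDT ((cuspSet k).isClosed.preimage π.continuous)
    apply h1
    rw [stalkIdeal_vanishingIdeal_preimage]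
    apply Ideal.le_radical
    apply Ideal.mem_map_of_mem
    rw [stalkIdeal_cuspSet_eq k (π P) (hP ▸ cuspGen_specializes_origin k)]
    exact Ideal.mem_map_of_mem _ (Ideal.subset_span rfl)
  have hf0 : (π.stalkMap P).hom (germF k (π P)) ≠ 0 := by
    rw [hf]
    have hgne : b ^ 2 - a ≠ 0 := by
      intro h
      apply ha2
      rw [sub_eq_zero] at h
      rw [← h]
      exact Ideal.pow_mem_pow hbmem 2
    exact mul_ne_zero (pow_ne_zero 2 hap.ne_zero) hgne
  have hr : r ≠ 0 := by
    rintro rfl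
    apply hf0
    have h0 : Ideal.span (Set.range z) = ⊥ := by
      rw [Set.range_eq_empty, Ideal.span_empty]
    simpa [h0] using hfD
  -- (3) `I_B ≤ (a)`: `B ⊇ π⁻¹(s)` and `√(𝔪_s · 𝒪_{Z₁,P}) = √(a) = (a)`
  have hBa : Ideal.span {∏ j ∈ J, w j} ≤ Ideal.span {a} := by
    rw [← hIB]
    have h1 : stalkIdeal (vanishingIdeal ⟨closure B, isClosed_closure⟩) P ≤
        stalkIdeal (vanishingIdeal ((⟨{origin k}, isClosed_origin k⟩ : Closeds (plane k)).preimage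
          π.continuous)) P := by
      apply stalkIdeal_mono
      apply vanishingIdeal_antimono
      change π ⁻¹' {origin k} ⊆ closure B
      exact hEB.trans subset_closure
    refine h1.trans ?_
    rw [stalkIdeal_vanishingIdeal_preimage, ← stalkIdeal_comap_eq_map_stalkMap]
    change (stalkIdeal ((originSheaf k).comap π) P).radical ≤ _
    rw [hI, ((Ideal.span_singleton_prime hap.ne_zero).mpr hap).radical]
  have hJ : J.Nonempty := by
    rw [Finset.nonempty_iff_ne_empty]
    rintro rfl
    rw [Finset.prod_empty, Ideal.span_singleton_one, top_le_iff, Ideal.span_singleton_eq_top] at hBa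
    exact hap.not_unit hBa
  have he : e ≠ 0 := by
    rintro rfl
    obtain ⟨j, -⟩ := hJ
    exact j.elim0
  have hre : r + e = 2 := by
    have h := hdim'.symm.trans hdim
    exact_mod_cast h
  obtain rfl : r = 1 := by omega
  obtain rfl : e = 1 := by omega
  have hJ0 : J = {0} := by
    obtain ⟨j, hj⟩ := hJ
    exact Finset.eq_singleton_iff_unique_mem.mpr ⟨Fin.eq_zero j ▸ hj, fun j _ => Fin.eq_zero j⟩
  rw [hJ0, Finset.prod_singleton] at hBa
  -- (4) `𝔪 = (z, w) ≤ 𝔭_{η'} + (a)`, but `b ∉ 𝔭_{η'} + (a)`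
  have hmle : maximalIdeal (Z₁.presheaf.stalk P) ≤ primeOfSpecializes hsp ⊔ Ideal.span {a} := by
    rw [← hzw, Ideal.span_le]
    rintro x (⟨i, rfl⟩ | ⟨i, rfl⟩)
    · exact Ideal.mem_sup_left (hDq (Ideal.subset_span ⟨i, rfl⟩))
    · refine Ideal.mem_sup_right (hBa ?_)
      rw [Fin.eq_zero i]
      exact Ideal.subset_span rfl
  obtain ⟨q, hq, t, ht, hqt⟩ := Submodule.mem_sup.mp (hmle hbmem)
  obtain ⟨l, rfl⟩ := Ideal.mem_span_singleton'.mp ht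
  have hq' : b - l * a ∈ primeOfSpecializes hsp := by
    have : b - l * a = q := by rw [← hqt]; ring
    rw [this]
    exact hq
  have hmem : a * (1 - l ^ 2 * a) ∈ primeOfSpecializes hsp := by
    have : a * (1 - l ^ 2 * a) = (b - l * a) * (b + l * a) - (b ^ 2 - a) := by ring
    rw [this]
    exact Ideal.sub_mem _ (Ideal.mul_mem_right _ _ hq') hgq
  rcases Ideal.IsPrime.mem_or_mem inferInstance hmem with h | h
  · exact haq h
  · have h1 : (1 : Z₁.presheaf.stalk P) ∈ maximalIdeal (Z₁.presheaf.stalk P) := by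
      have := Ideal.add_mem _ (hqle h) (Ideal.mul_mem_left _ (l ^ 2) hamem)
      rwa [sub_add_cancel] at this
    exact (maximalIdeal.isMaximal (Z₁.presheaf.stalk P)).ne_top
      ((Ideal.eq_top_iff_one _).mpr h1)

/-! ## §R — an ideal sheaf with reduced closed subscheme is radical -/

/-- An ideal sheaf whose closed subscheme is reduced is radical (the argument of
`AlterationsNodalBoundary.lean`, `radical_eq_of_isReduced_subscheme`, repeated here to keep the
imports of this file small: on an affine open `U`, `J(U)` is the kernel of `Γ(X, U) → Γ(V(J) ∩ U)`,
a reduced ring). [folklore] -/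
private theorem radical_eq_of_isReduced_subscheme' {X : Scheme.{u}} (J : X.IdealSheafData)
    [IsReduced J.subscheme] : J.radical = J := by
  ext U : 2
  rw [radical_ideal]
  haveI : IsReduced (J.subschemeCover.openCover.X U) :=
    isReduced_of_isOpenImmersion (J.subschemeCover.openCover.f U)
  have h : IsReduced (Spec (.of (Γ(X, (U : X.Opens)) ⧸ J.ideal U))) := this
  rw [affine_isReduced_iff] at h
  exact ((Ideal.isRadical_iff_quotient_reduced _).mpr h).radical

/-! ## §P — the blow-up of the plane at the origin off the origin -/

/-- `z ∈ Z ∖ supp 𝔪_s` iff `z ≠ s`. [folklore] -/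
private theorem mem_centreCompl_originSheaf {z : plane k} :
    z ∈ centreCompl (originSheaf k) ↔ z ≠ origin k := by
  change z ∈ ((originSheaf k).support : Set (plane k))ᶜ ↔ _
  rw [coe_support_originSheaf, Set.mem_compl_iff, Set.mem_singleton_iff]

/-- A blow-up of the plane at the origin has a point over the generic point of the cusp. [folklore] -/
private theorem exists_over_cuspGen {Z' : Scheme.{u}} {σ : Z' ⟶ plane k}
    (hσ : IsBlowup σ (originSheaf k)) : ∃ η : Z', σ η = cuspGen k := by
  haveI := hσ.isIso_compl
  have hmem : cuspGen k ∈ ((originSheaf k).support : Set (plane k))ᶜ := by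
    rw [coe_support_originSheaf]
    exact cuspGen_ne_origin k
  obtain ⟨w, hw⟩ := (σ ∣_ ⟨((originSheaf k).support : Set (plane k))ᶜ,
    (originSheaf k).support.isClosed.isOpen_compl⟩).homeomorph.surjective ⟨cuspGen k, hmem⟩
  refine ⟨w.1, ?_⟩
  have h1 := congrArg Subtype.val hw
  rw [Scheme.Hom.homeomorph_apply, morphismRestrict_base_coe] at h1
  exact h1

/-- **Specialisations lift off the origin**: if `σ η` is the generic point of the cusp and `σ v`
a point of the cusp other than the origin, then `η ⤳ v` (over `Z ∖ {s}` the blow-up is an open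
immersion). [folklore] -/
private theorem specializes_of_isBlowup {Z' : Scheme.{u}} {σ : Z' ⟶ plane k}
    (hσ : IsBlowup σ (originSheaf k)) {η v : Z'} (hη : σ η = cuspGen k)
    (hv : σ v ∈ cuspSet k) (hv' : σ v ≠ origin k) : η ⤳ v := by
  haveI := hσ.isOpenImmersion_preimage_compl_ι
  have hηV : η ∈ σ ⁻¹ᵁ centreCompl (originSheaf k) := by
    change σ η ∈ centreCompl (originSheaf k)
    rw [mem_centreCompl_originSheaf, hη]
    exact cuspGen_ne_origin k
  have hvV : v ∈ σ ⁻¹ᵁ centreCompl (originSheaf k) := by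
    change σ v ∈ centreCompl (originSheaf k)
    rw [mem_centreCompl_originSheaf]
    exact hv'
  have hj := ((σ ⁻¹ᵁ centreCompl (originSheaf k)).ι ≫ σ).isOpenEmbedding
  have h1 : ((σ ⁻¹ᵁ centreCompl (originSheaf k)).ι ≫ σ) ⟨η, hηV⟩ ⤳
      ((σ ⁻¹ᵁ centreCompl (originSheaf k)).ι ≫ σ) ⟨v, hvV⟩ := by
    rw [Scheme.Hom.comp_apply, Scheme.Hom.comp_apply, Scheme.Opens.ι_apply, Scheme.Opens.ι_apply]
    change σ η ⤳ σ v
    rw [hη]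
    exact (mem_cuspSet_iff_specializes k (σ v)).mp hv
  have h2 : (⟨η, hηV⟩ : ↥(σ ⁻¹ᵁ centreCompl (originSheaf k))) ⤳ ⟨v, hvV⟩ :=
    hj.isInducing.specializes_iff.mp h1
  exact h2.map (σ ⁻¹ᵁ centreCompl (originSheaf k)).ι.continuous

/-- The strict transform of the cusp under a blow-up of the plane at the origin is the closure of
its point over the generic point of the cusp. [folklore] -/
private theorem closure_preimage_diff_eq {Z' : Scheme.{u}} {σ : Z' ⟶ plane k}
    (hσ : IsBlowup σ (originSheaf k)) {η : Z'} (hη : σ η = cuspGen k) :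
    closure (σ ⁻¹' ((cuspSet k : Set (plane k)) \ {origin k})) = closure {η} := by
  apply subset_antisymm
  · refine closure_minimal ?_ isClosed_closure
    rintro v ⟨hv, hv'⟩
    exact (specializes_of_isBlowup hσ hη hv hv').mem_closure
  · refine closure_mono (Set.singleton_subset_iff.mpr ⟨?_, ?_⟩)
    · rw [hη]
      exact cuspGen_mem_cuspSet k
    · rw [hη, Set.mem_singleton_iff]
      exact cuspGen_ne_origin k

/-- **Off the origin the strict transform is regular** (there the blow-up is an open immersion
and the strict transform is the preimage of the cusp, which is regular off the origin). [folklore] -/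
private theorem isRegularLocalRing_quotient_of_not_over_origin [CharZero k] {Z' : Scheme.{u}}
    {σ : Z' ⟶ plane k} (hσ : IsBlowup σ (originSheaf k)) {η v : Z'} (hη : σ η = cuspGen k)
    (hv : σ v ∈ cuspSet k) (hv' : σ v ≠ origin k) :
    IsRegularLocalRing (Z'.presheaf.stalk v ⧸
      stalkIdeal (vanishingIdeal ⟨closure {η}, isClosed_closure⟩) v) := by
  haveI := hσ.isOpenImmersion_preimage_compl_ι
  have hvV : v ∈ σ ⁻¹ᵁ centreCompl (originSheaf k) := by
    change σ v ∈ centreCompl (originSheaf k)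
    rw [mem_centreCompl_originSheaf]
    exact hv'
  have h1 : IsRegularLocalRing
      ((σ ⁻¹ᵁ centreCompl (originSheaf k) : Scheme.{u}).presheaf.stalk ⟨v, hvV⟩ ⧸
        stalkIdeal (vanishingIdeal ((cuspSet k).preimage
          ((σ ⁻¹ᵁ centreCompl (originSheaf k)).ι ≫ σ).continuous)) ⟨v, hvV⟩) := by
    rw [isRegularLocalRing_quotient_iff_of_isOpenImmersion, Scheme.Hom.comp_apply,
      Scheme.Opens.ι_apply]
    exact isRegularLocalRing_stalk_quotient_of_ne k (σ v) ((mem_cuspSet_iff k _).mp hv) hv'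
  have heq : (⟨closure {η}, isClosed_closure⟩ : Closeds Z').preimage
      (σ ⁻¹ᵁ centreCompl (originSheaf k)).ι.continuous =
      (cuspSet k).preimage ((σ ⁻¹ᵁ centreCompl (originSheaf k)).ι ≫ σ).continuous := by
    ext ⟨x, hx⟩
    change x ∈ closure {η} ↔ ((σ ⁻¹ᵁ centreCompl (originSheaf k)).ι ≫ σ) ⟨x, hx⟩ ∈
      (cuspSet k : Set (plane k))
    rw [Scheme.Hom.comp_apply, Scheme.Opens.ι_apply]
    constructor
    · intro h
      have hsub : closure {η} ⊆ σ ⁻¹' (cuspSet k : Set (plane k)) :=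
        closure_minimal (Set.singleton_subset_iff.mpr
          (show σ η ∈ (cuspSet k : Set (plane k)) by rw [hη]; exact cuspGen_mem_cuspSet k))
          ((cuspSet k).isClosed.preimage σ.continuous)
      exact hsub h
    · intro h
      exact (specializes_of_isBlowup hσ hη h
        ((mem_centreCompl_originSheaf (z := σ x)).mp hx)).mem_closure
  rw [← heq] at h1
  exact (isRegularLocalRing_quotient_iff_of_isOpenImmersion
    (σ ⁻¹ᵁ centreCompl (originSheaf k)).ι ⟨closure {η}, isClosed_closure⟩ ⟨v, hvV⟩).mp h1

/-! ## §I — before the first blow-up (isomorphisms) -/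

/-- Before any blow-up (`σ` an isomorphism) the reduced preimage of the cusp is regular at every
point not over `s`. [folklore] -/
private theorem isRegularLocalRing_quotient_preimage_of_isIso [CharZero k] {Z' : Scheme.{u}}
    (σ : Z' ⟶ plane k) [IsIso σ] {v : Z'} (hv : σ v ∈ cuspSet k) (hv' : σ v ≠ origin k) :
    IsRegularLocalRing (Z'.presheaf.stalk v ⧸
      stalkIdeal (vanishingIdeal ((cuspSet k).preimage σ.continuous)) v) :=
  (isRegularLocalRing_quotient_iff_of_isOpenImmersion σ (cuspSet k) v).mpr
    (isRegularLocalRing_stalk_quotient_of_ne k (σ v) ((mem_cuspSet_iff k _).mp hv) hv')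

/-- Before any blow-up (`σ` an isomorphism) the reduced preimage of the cusp is not regular at the point over `s`. [folklore] -/
private theorem not_isRegularLocalRing_quotient_preimage_of_isIso {Z' : Scheme.{u}}
    (σ : Z' ⟶ plane k) [IsIso σ] {v : Z'} (hv : σ v = origin k) :
    ¬ IsRegularLocalRing (Z'.presheaf.stalk v ⧸
      stalkIdeal (vanishingIdeal ((cuspSet k).preimage σ.continuous)) v) := by
  rw [isRegularLocalRing_quotient_iff_of_isOpenImmersion σ (cuspSet k) v, hv]
  exact not_isRegularLocalRing_stalk_quotient_origin k

/-! ## §S — the shape of any `𝓑`-permissible sequence over the cusp with `hsing` at every step -/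

/-- **Invariant of the sequence.** Along any `IsBPermissibleSequence` starting from the cusp
`X ⊆ 𝔸²` with empty boundary, EITHER no genuine blow-up has happened yet (`σ` is an
isomorphism, `X' = σ⁻¹ X`, `B' = ∅`), OR exactly one has, namely the blow-up of the origin:
`σ` is a blow-up of `𝔸²` along `𝔪_s`, `X'` is the closure of its point over the generic point of
`X`, and `B' = σ⁻¹(s)` — no further centre is admissible, the strict transform being regular. [folklore] -/
private theorem seq_invariant [CharZero k] {Z' : Scheme.{u}} {σ : Z' ⟶ plane k} {X' B' : Set Z'}
    (h : IsBPermissibleSequence (cuspSet k : Set (plane k)) (∅ : Set (plane k)) σ X' B') :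
    (IsIso σ ∧ X' = σ ⁻¹' (cuspSet k : Set (plane k)) ∧ B' = ∅) ∨
    (IsBlowup σ (originSheaf k) ∧ (∃ η' : Z', σ η' = cuspGen k ∧ X' = closure {η'}) ∧
      B' = σ ⁻¹' {origin k}) := by
  induction h with
  | refl =>
    left
    refine ⟨inferInstance, ?_, rfl⟩
    ext x
    simp
  | @blowup Z' Z'' σ X' B' h C τ hτ hreg hsub hsing hperm hnc ih =>
    -- the centre lies in the strict transform
    have hCX : (C.support : Set Z') ⊆ closure X' := by
      intro x hx
      have hx' : x ∈ ((vanishingIdeal (⟨closure X', isClosed_closure⟩ : Closeds Z')).support :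
          Set Z') := support_antitone hsub hx
      rw [coe_support_vanishingIdeal] at hx'
      exact hx'
    rcases ih with ⟨hiso, hX, hB⟩ | ⟨hbl, ⟨η', hη, hX⟩, hB⟩
    · -- no genuine blow-up so far
      subst hX hB
      have hXc : IsClosed (σ ⁻¹' (cuspSet k : Set (plane k))) :=
        (cuspSet k).isClosed.preimage σ.continuous
      have hcl : (⟨closure (σ ⁻¹' (cuspSet k : Set (plane k))), isClosed_closure⟩ : Closeds Z') =
          (cuspSet k).preimage σ.continuous := Closeds.ext hXc.closure_eq
      -- every point of the centre lies over the origin (`hsing` + regularity off the origin)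
      have hCo : ∀ x ∈ (C.support : Set Z'), σ x = origin k := by
        intro x hx
        by_contra hne
        apply hsing x hx
        rw [hcl]
        have hx' : σ x ∈ cuspSet k := by
          have := hCX hx
          rw [hXc.closure_eq] at this
          exact this
        exact isRegularLocalRing_quotient_preimage_of_isIso σ hx' hne
      by_cases hC0 : C.support = ⊥
      · -- empty centre: `C = ⊤`, `τ` is an isomorphism
        have hC : C = ⊤ := (support_eq_bot_iff C).mp hC0
        subst hC
        haveI : IsIso τ := hτ.isIso isEffectiveCartier_top
        left
        refine ⟨inferInstance, ?_, ?_⟩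
        · have h1 : τ ⁻¹' (σ ⁻¹' (cuspSet k : Set (plane k)) \
              ((⊤ : Z'.IdealSheafData).support : Set Z')) =
              (τ ≫ σ) ⁻¹' (cuspSet k : Set (plane k)) := by
            ext x
            simp
          rw [h1, ((cuspSet k).isClosed.preimage (τ ≫ σ).continuous).closure_eq]
        · ext x
          simp
      · -- the first genuine blow-up: the centre is the point over the origin, `C = σ^* 𝔪_s`
        right
        have hne : (C.support : Set Z').Nonempty := Closeds.coe_nonempty.mpr hC0
        obtain ⟨x₀, hx₀⟩ := hne
        have hσx₀ : σ x₀ = origin k := hCo x₀ hx₀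
        have hinj : ∀ a b : Z', σ a = σ b → a = b := fun a b hab =>
          σ.homeomorph.injective (by simpa using hab)
        have hsupp : (C.support : Set Z') = {x₀} := by
          ext x
          constructor
          · intro hx
            exact hinj _ _ ((hCo x hx).trans hσx₀.symm)
          · rintro rfl
            exact hx₀
        have hpre : σ ⁻¹' {origin k} = {x₀} := by
          ext x
          constructor
          · intro hx
            exact hinj _ _ ((Set.mem_singleton_iff.mp hx).trans hσx₀.symm)
          · rintro rfl
            exact hσx₀
        haveI : IsReduced C.subscheme := hreg.isReduced
        have hC : C = (originSheaf k).comap σ := by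
          rw [originSheaf, comap_vanishingIdeal_of_isOpenImmersion σ]
          apply eq_vanishingIdeal_of_radical (radical_eq_of_isReduced_subscheme' C)
          ext1
          rw [hsupp, Closeds.coe_preimage]
          change ({x₀} : Set Z') = σ ⁻¹' {origin k}
          rw [hpre]
        rw [hC] at hτ
        have hbl : IsBlowup (τ ≫ σ) (originSheaf k) := by
          have := hτ.comp_iso (asIso σ)
          rwa [asIso_hom, asIso_inv, ← Scheme.IdealSheafData.comap_comp, IsIso.inv_hom_id,
            Scheme.IdealSheafData.comap_id] at this
        refine ⟨hbl, ?_, ?_⟩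
        · obtain ⟨η, hη⟩ := exists_over_cuspGen hbl
          refine ⟨η, hη, ?_⟩
          rw [← closure_preimage_diff_eq hbl hη, hsupp]
          congr 1
          ext x
          simp only [Set.mem_preimage, Set.mem_sdiff, Set.mem_singleton_iff, Scheme.Hom.comp_apply]
          constructor
          · rintro ⟨h1, h2⟩
            exact ⟨h1, fun h3 => h2 (hinj _ _ (h3.trans hσx₀.symm))⟩
          · rintro ⟨h1, h2⟩
            exact ⟨h1, fun h3 => h2 (h3 ▸ hσx₀)⟩
        · ext x
          simp only [Set.mem_preimage, Set.empty_union, Set.mem_singleton_iff,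
            Scheme.Hom.comp_apply, hsupp]
          constructor
          · intro h3
            exact h3 ▸ hσx₀
          · intro h3
            exact hinj _ _ (h3.trans hσx₀.symm)
    · -- after the blow-up of the origin no further centre is admissible
      subst hX hB
      have hC0 : C.support = ⊥ := by
        by_contra hne
        obtain ⟨x, hx⟩ := Closeds.coe_nonempty.mpr hne
        have hxX : x ∈ closure {η'} := by
          have := hCX hx
          rwa [closure_closure] at this
        have hspx : η' ⤳ x := specializes_iff_mem_closure.mpr hxX
        apply hsing x hx
        rw [show (⟨closure (closure {η'}), isClosed_closure⟩ : Closeds Z') =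
          ⟨closure {η'}, isClosed_closure⟩ from Closeds.ext closure_closure]
        by_cases hxo : σ x = origin k
        · exact isRegularLocalRing_quotient_of_over_origin hbl x hxo η' hη hspx
        · have hxc : σ x ∈ cuspSet k := by
            rw [mem_cuspSet_iff_specializes, ← hη]
            exact hspx.map σ.continuous
          exact isRegularLocalRing_quotient_of_not_over_origin hbl hη hxc hxo
      have hC : C = ⊤ := (support_eq_bot_iff C).mp hC0
      subst hC
      haveI : IsIso τ := hτ.isIso isEffectiveCartier_top
      right
      refine ⟨hbl.iso_comp (asIso τ), ?_, ?_⟩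
      · obtain ⟨η'', hη''⟩ := τ.homeomorph.surjective η'
        rw [Scheme.Hom.homeomorph_apply] at hη''
        refine ⟨η'', ?_, ?_⟩
        · rw [Scheme.Hom.comp_apply, hη'', hη]
        · rw [support_top, Closeds.coe_bot, Set.sdiff_empty,
            (isClosed_closure.preimage τ.continuous).closure_eq]
          change τ.homeomorph ⁻¹' closure {η'} = closure {η''}
          rw [τ.homeomorph.preimage_closure]
          congr 1
          ext x
          simp only [Set.mem_preimage, Set.mem_singleton_iff, Scheme.Hom.homeomorph_apply]
          rw [← hη'']
          exact ⟨fun h3 => τ.homeomorph.injective (by simpa using h3), fun h3 => h3 ▸ rfl⟩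
      · rw [support_top, Closeds.coe_bot, Set.union_empty]
        ext x
        simp

end Literature.AlgebraicGeometry.Resolution.CuspCounterexample

namespace Literature.AlgebraicGeometry.Resolution

/-! ## The refutation -/

-- F-32b hygiene (res-hironaka 2026-08-27, step (ii) of (iii) → (ii) → (i)): the superseded fact named below is to be
-- tagged `@[deprecated … use CossartJannsenSaito2020EmbeddedSequenceB]` in
-- `EmbeddedResolutionExcellentSurfacesSequence.lean`; this certificate must keep naming it, so the deprecation
-- linter is switched off for this one declaration. REMOVE-WHEN: the superseded decl is deleted from the tree.
set_option linter.deprecated false in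
open CuspCounterexample Scheme.IdealSheafData in
/-- **`CossartJannsenSaito2020EmbeddedSequence` is false as typed.** Witness: the cuspidal cubic
`X = V(x₀² − x₁³) ⊂ Z = 𝔸²_k`, `k = ℚ` (lifted to the universe `u`). By `seq_invariant` a
`𝓑`-permissible sequence with `hsing` at every step is either an isomorphism (then the end clause
«`X₁` transversal with `B₁`» makes `𝒪_{X,s}` regular at the cusp point — it is not) or the single
blow-up of the cusp point followed by isomorphisms (then over `s` the strict transform is tangent
to the exceptional curve: `not_isTransversalWith_of_over_origin`; a point of `X₁` over `s` exists
because `π` is proper). What is refuted is the TYPED clause «`D_i ⊂ (X_i)_sing` at every step»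
(the Introduction's sentence, book p. 6) in conjunction with the printed end state; the book's own
Def. 6.8 / Thm. 6.9 (a) put the later centres in `(X_i)_sing ∪ (X_i ∩ B_i)` («for the sequence
`S(X, ∅)`, `𝓑_i` is not empty for `i > 0`», p. 82), see `CossartJannsenSaito2020EmbeddedSequenceB`.
[cite: CossartJannsenSaito2020, Thm. 1.4 "More precisely" (p. 6) vs. Def. 6.8 (p. 82), Thm. 6.9 (a) (p. 83) and p. 7]
[cite: Hartshorne1977, Ch. I, Exercise 4.10 (blowing up the cuspidal cubic) and Exercise 5.6 (a)] -/
theorem not_cossartJannsenSaito2020EmbeddedSequence :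
    ¬ CossartJannsenSaito2020EmbeddedSequence.{u} := by
  intro H
  haveI : CharZero (ULift.{u} ℚ) := (ULift.ringEquiv (R := ℚ)).toRingHom.charZero
  haveI := isClosedImmersion_cuspImm (ULift.{u} ℚ)
  haveI := isReduced_cuspScheme (ULift.{u} ℚ)
  haveI := isNoetherian_plane (ULift.{u} ℚ)
  obtain ⟨Z₁, π, X₁, B₁, hseq, -, hproper, -, -, -, -, -, htr⟩ :=
    H (cuspScheme (ULift.{u} ℚ)) (plane (ULift.{u} ℚ)) (cuspImm (ULift.{u} ℚ))
      (isRegular_plane _) (isExcellent_plane _) (topologicalKrullDim_cuspScheme _)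
  rw [range_cuspImm] at hseq
  rcases seq_invariant hseq with ⟨hiso, hX, hB⟩ | ⟨hbl, ⟨η', hη, hX⟩, hB⟩
  · -- no blow-up at all: transversality at the cusp point would make the cusp regular there
    subst hX
    obtain ⟨x₀, hx₀⟩ := π.homeomorph.surjective (origin (ULift.{u} ℚ))
    rw [Scheme.Hom.homeomorph_apply] at hx₀
    have hx₀X : x₀ ∈ π ⁻¹' (cuspSet (ULift.{u} ℚ) : Set (plane (ULift.{u} ℚ))) := by
      change π x₀ ∈ (cuspSet (ULift.{u} ℚ) : Set (plane (ULift.{u} ℚ)))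
      rw [hx₀]
      exact origin_mem_cuspSet _
    obtain ⟨hreg, r, e, z, w, J, hdim, hzw, hID, -⟩ := htr x₀ hx₀X
    have hrs : IsRsopPart z := ⟨hreg, e, w, hdim, hzw⟩
    have h1 := hrs.isRegularLocalRing_quotient
    rw [← hID] at h1
    have hcl : (⟨closure (π ⁻¹' (cuspSet (ULift.{u} ℚ) : Set (plane (ULift.{u} ℚ)))),
        isClosed_closure⟩ : Closeds Z₁) = (cuspSet (ULift.{u} ℚ)).preimage π.continuous :=
      Closeds.ext ((cuspSet (ULift.{u} ℚ)).isClosed.preimage π.continuous).closure_eq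
    rw [hcl] at h1
    exact not_isRegularLocalRing_quotient_preimage_of_isIso π hx₀ h1
  · -- the blow-up of the cusp point: over `s` the strict transform is tangent to `E = π⁻¹(s)`
    subst hX hB
    haveI := hproper
    have hclosed : IsClosed (π '' closure {η'}) := π.isClosedMap _ isClosed_closure
    have horigin : origin (ULift.{u} ℚ) ∈ π '' closure {η'} := by
      have h1 : cuspGen (ULift.{u} ℚ) ∈ π '' closure {η'} := ⟨η', subset_closure rfl, hη⟩
      have h2 : closure {cuspGen (ULift.{u} ℚ)} ⊆ π '' closure {η'} :=
        closure_minimal (Set.singleton_subset_iff.mpr h1) hclosed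
      exact h2 (cuspGen_specializes_origin _).mem_closure
    obtain ⟨P, hP1, hP2⟩ := horigin
    have hsp : η' ⤳ P := specializes_iff_mem_closure.mpr hP1
    refine not_isTransversalWith_of_over_origin hbl P hP2 η' hη hsp hP1 (subset_closure rfl)
      (closure_minimal (Set.singleton_subset_iff.mpr ?_)
        ((cuspSet (ULift.{u} ℚ)).isClosed.preimage π.continuous)) le_rfl htr
    change π η' ∈ (cuspSet (ULift.{u} ℚ) : Set (plane (ULift.{u} ℚ)))
    rw [hη]
    exact cuspGen_mem_cuspSet _

end Literature.AlgebraicGeometry.Resolution
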